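import Summits.CriticalPhenomena.PercolationContinuityZ3.Theorems.PercRayRenewalJumpLineAvoidanceDecayVoidSecondMoment
import Literature.Probability.Percolation.TwoPointFunction
import Mathlib.Analysis.PSeries
import HarnessLib

/-!
# Axial two-point decay forces line-avoidance decay (second moment on the axis)

Route `PercRayRenewal`, item `JumpLineAvoidanceDecay` (stmt-CriticalPhenomena-4626), helper file.
For nearest-neighbour bond percolation on `ℤ³` at ANY density `p` with `θ(p) > 0`: if the
connected axial two-point function decays like a power,
`τ_p(0, n e₀) - θ(p)² ≤ C n^{-a}` (`n ≥ 1`, some `a > 0`), then so does the line-avoidance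
probability `e_m = P_p(none of e₀, 2e₀, …, m e₀ lies in an infinite cluster)`:
`e_m ≤ C' m^{-κ}` with `κ = min(a, 1) / 2`.

Proof (Chebyshev / second moment on the axis segment). Apply the second-moment void bound
`real_void_mul_sq_le_sum_openConn_sub` (sibling file `…VoidSecondMoment`) to
`T = {e₀, …, m e₀}`: `e_m (θ m)² ≤ Σ_{i,j=1}^m (τ_p(i e₀, j e₀) - θ²)`. By translation
invariance and symmetry of `τ_p` (`tau_eq_tau_zero_sub`, `tau_comm` of
`TwoPointFunction.lean`), `τ_p(i e₀, j e₀) = τ_p(0, |j - i| e₀)`, so the diagonal terms are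
`≤ 1` and the off-diagonal ones `≤ max(C,0) |j - i|^{-2κ} ≤ max(C,0) m^{1-κ} |j - i|^{-(1+κ)}`
(`|j - i| ≤ m`); summing the convergent series `Z = Σ_{z ∈ ℤ} |z|^{-(1+κ)}`
(`Real.summable_abs_int_rpow`) over each row gives
`e_m θ² m² ≤ m + max(C,0) Z m · m^{1-κ} ≤ (1 + max(C,0) Z) m^{2-κ}`, i.e.
`e_m ≤ (1 + max(C,0) Z) θ^{-2} · m^{-κ}`.

## References

* G. Grimmett, *Percolation*, 2nd ed., Springer 1999, §8.5 p. 213 (`τ_p(x,y) ≥ θ(p)²`,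
  uniqueness), §1.6 (translation invariance) [GrimmettPercolation1999].
-/

noncomputable section

namespace Summit.CriticalPhenomena.PercolationContinuityZ3.Theorems

open MeasureTheory Literature.Probability.Percolation Literature.Probability.LatticeModels

namespace AxialSecondMoment

/-- Reflection through the origin preserves the two-point function from the origin:
`τ_p(0, -x) = τ_p(0, x)` (translate by `x`, then swap the endpoints). [folklore] -/
theorem real_openConn_zero_neg (d : ℕ) (p : unitInterval) (x : Site d) :
    (bondPercolation (zdGraph d) p).real (openConn (0 : Site d) (-x)) =
      (bondPercolation (zdGraph d) p).real (openConn (0 : Site d) x) := by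
  have h := tau_eq_tau_zero_sub p x 0
  rw [zero_sub, tau_comm p x 0] at h
  exact h.symm

/-- Translation invariance along a coordinate axis:
`τ_p(i e_k, j e_k) = τ_p(0, (j - i) e_k)`. [folklore] -/
theorem real_openConn_single_single (d : ℕ) (p : unitInterval) (k : Fin d) (i j : ℤ) :
    (bondPercolation (zdGraph d) p).real (openConn (Pi.single k i : Site d) (Pi.single k j)) =
      (bondPercolation (zdGraph d) p).real (openConn (0 : Site d) (Pi.single k (j - i))) := by
  rw [Pi.single_sub]
  exact tau_eq_tau_zero_sub p (Pi.single k i : Site d) (Pi.single k j)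

/-- Reflection invariance along a coordinate axis: `τ_p(0, z e_k) = τ_p(0, |z| e_k)`.
[folklore] -/
theorem real_openConn_zero_single_natAbs (d : ℕ) (p : unitInterval) (k : Fin d) (z : ℤ) :
    (bondPercolation (zdGraph d) p).real (openConn (0 : Site d) (Pi.single k z)) =
      (bondPercolation (zdGraph d) p).real
        (openConn (0 : Site d) (Pi.single k (z.natAbs : ℤ))) := by
  rcases Int.natAbs_eq z with h | h
  · rw [← h]
  · calc (bondPercolation (zdGraph d) p).real (openConn (0 : Site d) (Pi.single k z))
        = (bondPercolation (zdGraph d) p).real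
            (openConn (0 : Site d) (Pi.single k (-(z.natAbs : ℤ)))) := by rw [← h]
      _ = (bondPercolation (zdGraph d) p).real
            (openConn (0 : Site d) (Pi.single k (z.natAbs : ℤ))) := by
          rw [Pi.single_neg]
          exact real_openConn_zero_neg d p _

/-- Transfer of the axial decay hypothesis to a pair of axis points: if
`τ_p(0, n e₀) - θ² ≤ C n^{-a}` for `n ≥ 1`, then for `i ≠ j` and every exponent `e ≤ a`,
`τ_p(i e₀, j e₀) - θ² ≤ max(C, 0) |j - i|^{-e}`. [folklore] -/
theorem real_openConn_single_sub_sq_le (p : unitInterval) {a C e : ℝ}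
    (hC : ∀ n : ℕ, 1 ≤ n →
      (bondPercolation (zdGraph 3) p).real (openConn (0 : Site 3) (Pi.single 0 (n : ℤ))) -
          theta (zdGraph 3) (0 : Site 3) p ^ 2 ≤ C * (n : ℝ) ^ (-a))
    (he : e ≤ a) (i j : ℕ) (hij : i ≠ j) :
    (bondPercolation (zdGraph 3) p).real
          (openConn (Pi.single 0 (i : ℤ) : Site 3) (Pi.single 0 (j : ℤ))) -
        theta (zdGraph 3) (0 : Site 3) p ^ 2 ≤
      max C 0 * ((((j : ℤ) - i).natAbs : ℕ) : ℝ) ^ (-e) := by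
  rw [real_openConn_single_single 3 p 0, real_openConn_zero_single_natAbs 3 p 0]
  have hn1 : 1 ≤ ((j : ℤ) - i).natAbs :=
    Int.natAbs_pos.2 (sub_ne_zero.2 (by exact_mod_cast hij.symm))
  have hn1' : (1 : ℝ) ≤ ((((j : ℤ) - i).natAbs : ℕ) : ℝ) := by exact_mod_cast hn1
  calc (bondPercolation (zdGraph 3) p).real
          (openConn (0 : Site 3) (Pi.single 0 ((((j : ℤ) - i).natAbs : ℕ) : ℤ))) -
        theta (zdGraph 3) (0 : Site 3) p ^ 2
      ≤ C * ((((j : ℤ) - i).natAbs : ℕ) : ℝ) ^ (-a) := hC _ hn1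
    _ ≤ max C 0 * ((((j : ℤ) - i).natAbs : ℕ) : ℝ) ^ (-a) :=
        mul_le_mul_of_nonneg_right (le_max_left _ _) (Real.rpow_nonneg (Nat.cast_nonneg _) _)
    _ ≤ max C 0 * ((((j : ℤ) - i).natAbs : ℕ) : ℝ) ^ (-e) :=
        mul_le_mul_of_nonneg_left (Real.rpow_le_rpow_of_exponent_le hn1' (neg_le_neg he))
          (le_max_right _ _)

/-- **The axial double sum.** If `F(i, i) ≤ 1` and `F(i, j) ≤ K |j - i|^{-2κ}` for `i ≠ j`
(`K ≥ 0`, `0 < κ ≤ 1`), then for `m ≥ 1`,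
`Σ_{i,j=1}^m F(i,j) ≤ (1 + K Z) · m · m^{1-κ}` with `Z = Σ_{z ∈ ℤ} |z|^{-(1+κ)} < ∞`:
bound `|j - i|^{-2κ} = |j - i|^{1-κ} |j - i|^{-(1+κ)} ≤ m^{1-κ} |j - i|^{-(1+κ)}` and sum each
row over all of `ℤ`. [folklore] -/
theorem sum_sum_le (F : ℕ → ℕ → ℝ) {K κ : ℝ} (hK : 0 ≤ K) (hκ0 : 0 < κ) (hκ1 : κ ≤ 1)
    (hdiag : ∀ i, F i i ≤ 1)
    (hoff : ∀ i j, i ≠ j → F i j ≤ K * ((((j : ℤ) - i).natAbs : ℕ) : ℝ) ^ (-(2 * κ)))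
    {m : ℕ} (hm : 1 ≤ m) :
    ∑ i ∈ Finset.Icc 1 m, ∑ j ∈ Finset.Icc 1 m, F i j ≤
      (1 + K * ∑' z : ℤ, ((z.natAbs : ℕ) : ℝ) ^ (-(1 + κ))) * ((m : ℝ) * (m : ℝ) ^ (1 - κ)) := by
  -- the comparison series `Z = Σ_{z ∈ ℤ} |z|^{-(1+κ)}`
  have hw0 : ∀ z : ℤ, 0 ≤ ((z.natAbs : ℕ) : ℝ) ^ (-(1 + κ)) := fun z =>
    Real.rpow_nonneg (Nat.cast_nonneg _) _
  have hws : Summable fun z : ℤ => ((z.natAbs : ℕ) : ℝ) ^ (-(1 + κ)) := by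
    have h := Real.summable_abs_int_rpow (b := 1 + κ) (by linarith)
    refine h.congr fun z => ?_
    rw [Nat.cast_natAbs, Int.cast_abs]
  set Z : ℝ := ∑' z : ℤ, ((z.natAbs : ℕ) : ℝ) ^ (-(1 + κ)) with hZ
  have hm0 : (0 : ℝ) < m := by exact_mod_cast hm
  have hm1 : (1 : ℝ) ≤ m := by exact_mod_cast hm
  set Q : ℝ := (m : ℝ) ^ (1 - κ) with hQ
  have hQ1 : 1 ≤ Q := Real.one_le_rpow hm1 (by linarith)
  have hQ0 : 0 ≤ Q := zero_le_one.trans hQ1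
  -- each row of the comparison series is at most `Z`
  have hrow : ∀ i : ℕ,
      ∑ j ∈ Finset.Icc 1 m, ((((j : ℤ) - i).natAbs : ℕ) : ℝ) ^ (-(1 + κ)) ≤ Z := by
    intro i
    have hinj : Set.InjOn (fun j : ℕ => (j : ℤ) - i) ↑(Finset.Icc 1 m) := by
      intro x _ y _ h
      have h' : (x : ℤ) = y := sub_left_inj.mp h
      exact_mod_cast h'
    calc ∑ j ∈ Finset.Icc 1 m, ((((j : ℤ) - i).natAbs : ℕ) : ℝ) ^ (-(1 + κ))
        = ∑ z ∈ (Finset.Icc 1 m).image (fun j : ℕ => (j : ℤ) - i),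
            ((z.natAbs : ℕ) : ℝ) ^ (-(1 + κ)) :=
          (Finset.sum_image (f := fun z : ℤ => ((z.natAbs : ℕ) : ℝ) ^ (-(1 + κ))) hinj).symm
      _ ≤ Z := hws.sum_le_tsum _ fun z _ => hw0 z
  -- the pointwise bound
  have hpt : ∀ i ∈ Finset.Icc 1 m, ∀ j ∈ Finset.Icc 1 m,
      F i j ≤ (if i = j then (1 : ℝ) else 0) +
        K * Q * ((((j : ℤ) - i).natAbs : ℕ) : ℝ) ^ (-(1 + κ)) := by
    intro i hi j hj
    have hnn : 0 ≤ K * Q * ((((j : ℤ) - i).natAbs : ℕ) : ℝ) ^ (-(1 + κ)) :=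
      mul_nonneg (mul_nonneg hK hQ0) (hw0 _)
    by_cases hij : i = j
    · subst hij
      rw [if_pos rfl]
      linarith [hdiag i]
    · rw [if_neg hij, zero_add]
      refine (hoff i j hij).trans ?_
      rw [Finset.mem_Icc] at hi hj
      set n : ℕ := ((j : ℤ) - i).natAbs with hn
      have hn1 : 1 ≤ n := Int.natAbs_pos.2 (sub_ne_zero.2 (by exact_mod_cast (Ne.symm hij)))
      have hnm : n ≤ m := by omega
      have hn0 : (0 : ℝ) < n := by exact_mod_cast hn1
      have hnm' : (n : ℝ) ≤ m := by exact_mod_cast hnm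
      have e1 : (n : ℝ) ^ (-(2 * κ)) = (n : ℝ) ^ (1 - κ) * (n : ℝ) ^ (-(1 + κ)) := by
        rw [← Real.rpow_add hn0]
        congr 1
        ring
      have e2 : (n : ℝ) ^ (1 - κ) ≤ Q := Real.rpow_le_rpow (Nat.cast_nonneg n) hnm' (by linarith)
      rw [e1]
      calc K * ((n : ℝ) ^ (1 - κ) * (n : ℝ) ^ (-(1 + κ)))
          ≤ K * (Q * (n : ℝ) ^ (-(1 + κ))) :=
            mul_le_mul_of_nonneg_left (mul_le_mul_of_nonneg_right e2 (hw0 _)) hK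
        _ = K * Q * (n : ℝ) ^ (-(1 + κ)) := (mul_assoc _ _ _).symm
  -- summation
  have hcard : (Finset.Icc 1 m).card = m := by simp
  calc ∑ i ∈ Finset.Icc 1 m, ∑ j ∈ Finset.Icc 1 m, F i j
      ≤ ∑ i ∈ Finset.Icc 1 m, ∑ j ∈ Finset.Icc 1 m,
          ((if i = j then (1 : ℝ) else 0) +
            K * Q * ((((j : ℤ) - i).natAbs : ℕ) : ℝ) ^ (-(1 + κ))) :=
        Finset.sum_le_sum fun i hi => Finset.sum_le_sum fun j hj => hpt i hi j hj
    _ = ∑ i ∈ Finset.Icc 1 m, ((∑ j ∈ Finset.Icc 1 m, if i = j then (1 : ℝ) else 0) +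
          K * Q * ∑ j ∈ Finset.Icc 1 m, ((((j : ℤ) - i).natAbs : ℕ) : ℝ) ^ (-(1 + κ))) := by
        refine Finset.sum_congr rfl fun i _ => ?_
        rw [Finset.sum_add_distrib, Finset.mul_sum]
    _ ≤ ∑ _i ∈ Finset.Icc 1 m, (1 + K * Q * Z) := by
        refine Finset.sum_le_sum fun i hi => add_le_add ?_ ?_
        · rw [Finset.sum_ite_eq, if_pos hi]
        · exact mul_le_mul_of_nonneg_left (hrow i) (mul_nonneg hK hQ0)
    _ = m * (1 + K * Q * Z) := by rw [Finset.sum_const, hcard, nsmul_eq_mul]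
    _ = m + K * Z * (m * Q) := by ring
    _ ≤ m * Q + K * Z * (m * Q) := by
        have : (m : ℝ) ≤ m * Q := le_mul_of_one_le_right hm0.le hQ1
        linarith
    _ = (1 + K * Z) * (m * Q) := by ring

end AxialSecondMoment

open AxialSecondMoment in
/-- **Axial two-point decay ⇒ line-avoidance decay** (any `p` with `θ(p) > 0`, `d = 3`): if
`τ_p(0, n e₀) - θ(p)² ≤ C n^{-a}` for all `n ≥ 1` (some `a > 0`), then
`P_p(∀ 1 ≤ i ≤ m, i e₀ ∉ C_∞) ≤ C' m^{-κ}` for all `m ≥ 1`, with `κ = min(a,1)/2` and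
`C' = (1 + max(C,0) Σ_{z ∈ ℤ} |z|^{-(1+κ)}) / θ(p)²`. Second moment on the axis segment
(`real_void_mul_sq_le_sum_openConn_sub`) plus translation invariance of `τ_p` and the row-sum
estimate `AxialSecondMoment.sum_sum_le`. [folklore] -/
theorem lineAvoidanceDecay_of_axialTwoPointDecay (p : unitInterval)
    (hθ : 0 < theta (zdGraph 3) (0 : Site 3) p)
    (hτ : ∃ a C : ℝ, 0 < a ∧ ∀ n : ℕ, 1 ≤ n →
      (bondPercolation (zdGraph 3) p).real (openConn (0 : Site 3) (Pi.single 0 (n : ℤ))) -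
          theta (zdGraph 3) (0 : Site 3) p ^ 2 ≤ C * (n : ℝ) ^ (-a)) :
    ∃ κ C : ℝ, 0 < κ ∧ ∀ m : ℕ, 1 ≤ m →
      (bondPercolation (zdGraph 3) p).real
          {ω | ∀ i : ℕ, 1 ≤ i → i ≤ m → ω ∉ percolatesAt (Pi.single 0 (i : ℤ) : Site 3)} ≤
        C * (m : ℝ) ^ (-κ) := by
  obtain ⟨a, C, ha, hC⟩ := hτ
  -- exponents and constants
  set κ : ℝ := min a 1 / 2 with hκ
  have hmin0 : 0 < min a 1 := lt_min ha one_pos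
  have hκ0 : 0 < κ := by rw [hκ]; linarith
  have hκ1 : κ ≤ 1 := by rw [hκ]; linarith [min_le_right a 1]
  have h2κ : 2 * κ ≤ a := by rw [hκ]; linarith [min_le_left a 1]
  have hK0 : 0 ≤ max C 0 := le_max_right _ _
  set Z : ℝ := ∑' z : ℤ, ((z.natAbs : ℕ) : ℝ) ^ (-(1 + κ)) with hZ
  have hZ0 : 0 ≤ Z := tsum_nonneg fun z => Real.rpow_nonneg (Nat.cast_nonneg _) _
  refine ⟨κ, (1 + max C 0 * Z) / theta (zdGraph 3) (0 : Site 3) p ^ 2, hκ0, fun m hm => ?_⟩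
  have hm0 : (0 : ℝ) < m := by exact_mod_cast hm
  -- the double-sum estimate for `F i j = τ(i e₀, j e₀) - θ²`
  have hdiag : ∀ i : ℕ,
      (bondPercolation (zdGraph 3) p).real
            (openConn (Pi.single 0 (i : ℤ) : Site 3) (Pi.single 0 (i : ℤ))) -
          theta (zdGraph 3) (0 : Site 3) p ^ 2 ≤ 1 := fun i =>
    (sub_le_self _ (sq_nonneg _)).trans measureReal_le_one
  have hoff : ∀ i j : ℕ, i ≠ j →
      (bondPercolation (zdGraph 3) p).real
            (openConn (Pi.single 0 (i : ℤ) : Site 3) (Pi.single 0 (j : ℤ))) -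
          theta (zdGraph 3) (0 : Site 3) p ^ 2 ≤
        max C 0 * ((((j : ℤ) - i).natAbs : ℕ) : ℝ) ^ (-(2 * κ)) :=
    fun i j hij => real_openConn_single_sub_sq_le p hC h2κ i j hij
  have hsum := sum_sum_le
    (fun i j : ℕ => (bondPercolation (zdGraph 3) p).real
        (openConn (Pi.single 0 (i : ℤ) : Site 3) (Pi.single 0 (j : ℤ))) -
      theta (zdGraph 3) (0 : Site 3) p ^ 2)
    hK0 hκ0 hκ1 hdiag hoff hm
  -- the second-moment void bound on `T = {e₀, …, m e₀}`
  have hv : Function.Injective (fun i : ℕ => (Pi.single 0 (i : ℤ) : Site 3)) := by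
    intro i j h
    have h0 := congrFun h 0
    simpa using h0
  have key := real_void_mul_sq_le_sum_openConn_sub 3 p
    ((Finset.Icc 1 m).image (fun i : ℕ => (Pi.single 0 (i : ℤ) : Site 3)))
  have hE : {ω : BondConfig (Site 3) | ∀ x ∈ (Finset.Icc 1 m).image
        (fun i : ℕ => (Pi.single 0 (i : ℤ) : Site 3)), ω ∉ percolatesAt x} =
      {ω : BondConfig (Site 3) | ∀ i : ℕ, 1 ≤ i → i ≤ m →
        ω ∉ percolatesAt (Pi.single 0 (i : ℤ) : Site 3)} := by
    ext ω
    simp only [Set.mem_setOf_eq, Finset.forall_mem_image, Finset.mem_Icc, and_imp]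
  have hcard : ((Finset.Icc 1 m).image (fun i : ℕ => (Pi.single 0 (i : ℤ) : Site 3))).card = m := by
    rw [Finset.card_image_of_injective _ hv]
    simp
  rw [hE, hcard] at key
  simp only [Finset.sum_image hv.injOn] at key
  -- assemble: `e θ² m² ≤ (1 + K Z) m² m^{-κ}`
  have hQ : (m : ℝ) * (m : ℝ) ^ (1 - κ) = (m : ℝ) ^ 2 * (m : ℝ) ^ (-κ) := by
    rw [sub_eq_add_neg, Real.rpow_add hm0, Real.rpow_one]
    ring
  have h3 : (bondPercolation (zdGraph 3) p).real
        {ω | ∀ i : ℕ, 1 ≤ i → i ≤ m → ω ∉ percolatesAt (Pi.single 0 (i : ℤ) : Site 3)} *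
        theta (zdGraph 3) (0 : Site 3) p ^ 2 * (m : ℝ) ^ 2 ≤
      (1 + max C 0 * Z) * (m : ℝ) ^ (-κ) * (m : ℝ) ^ 2 :=
    calc (bondPercolation (zdGraph 3) p).real
          {ω | ∀ i : ℕ, 1 ≤ i → i ≤ m → ω ∉ percolatesAt (Pi.single 0 (i : ℤ) : Site 3)} *
          theta (zdGraph 3) (0 : Site 3) p ^ 2 * (m : ℝ) ^ 2
        = (bondPercolation (zdGraph 3) p).real
            {ω | ∀ i : ℕ, 1 ≤ i → i ≤ m → ω ∉ percolatesAt (Pi.single 0 (i : ℤ) : Site 3)} *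
            (theta (zdGraph 3) (0 : Site 3) p * m) ^ 2 := by ring
      _ ≤ _ := key
      _ ≤ _ := hsum
      _ = (1 + max C 0 * Z) * (m : ℝ) ^ (-κ) * (m : ℝ) ^ 2 := by rw [hQ]; ring
  have h4 : (bondPercolation (zdGraph 3) p).real
        {ω | ∀ i : ℕ, 1 ≤ i → i ≤ m → ω ∉ percolatesAt (Pi.single 0 (i : ℤ) : Site 3)} *
        theta (zdGraph 3) (0 : Site 3) p ^ 2 ≤ (1 + max C 0 * Z) * (m : ℝ) ^ (-κ) :=
    le_of_mul_le_mul_right h3 (by positivity)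
  rw [div_mul_eq_mul_div, le_div_iff₀ (pow_pos hθ 2)]
  exact h4

end Summit.CriticalPhenomena.PercolationContinuityZ3.Theorems

end
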